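import Literature.MathematicalPhysics.QuantumFieldTheory.Balaban1983to89.B9Thm31SiteCoerciveReg335Y
import Literature.MathematicalPhysics.QuantumFieldTheory.Balaban1983to89.B9Eq3132CoerciveVariational

/-!
# `Balaban1983to89.B9Thm31SiteGpBoundsReg335Y` — T. Bałaban, *Propagators for lattice gauge theories in a background field*, Commun. Math. Phys.
# **99** (1985) 389–434 [Balaban1985BackgroundPropagators] Thm 3.1 p. 397 ∕ (3.25) p. 394 ∕ Thm 3.11 p. 416, with [4] = [Balaban1984PropagatorsII] p. 225:
# ★ **THEOREM 3.1 AT THE `L²` LEVEL — THE TWO-SIDED OPERATOR BOUNDS OF def-Y's `G′(U) = Δ′_a(U)⁻¹` ON THE (3.35) CLASS**: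
# `(4(d+1)+1)⁻¹ ≤ G′(U) ≤ 8·L^{2k}` as forms, `‖G′(U)Ψ‖ ≤ 8L^{2k}‖Ψ‖`, member-∕volume-∕k-∕N-∕U-uniformly (file 4 of the site-coercivity set;
# files 1–3c = `B9Thm31SiteCoercive{FlatBlockY, TaxiBlockY, GaugeBlockY, Reg335CubeY, Reg335BlockY, Reg335Y}`)

statement-level skeleton of published theorems with citation tags; proofs where landed; nothing here is a claim about the Yang–Mills mass gap

THE PRINT (verbatim).  p. 394–395, (3.25): *«Rf = (I − G′Q′\*(Q′G′²Q′\*)⁻¹Q′G′)f, where G′ = G′(U) = (Δ′_a)⁻¹. We do not know yet if the operators in the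
above formula are well defined. Assuming some regularity of the configuration U it can be easily shown that the operator Δ′_a is positive. This implies
positivity of the operators G′, Q′G′²Q′\*, hence the existence of the operator R.»*  Thm 3.1 p. 397 is stated for the backgrounds of the class (3.35)
(`M` large, `α₀` small) and bounds the kernels of `G(U)`, `G′(U)` by `O(1)·(Lʲη)²`-sized, exponentially decaying majorants ((3.42)); Thm 3.11 p. 416: *«the
operators Δ′_a, G′, (Q′G′²Q′\*)⁻¹, Δ_a, G are positive definite»*; [4] p. 225: *«The operator G′ = Δ′_a^{−1} is a well defined, positive operator»*.

WHY THIS FILE (cell `pub-ymgap`, Track A node N06 [B9], width seat `pub-ymgap-dag-n06-w1`, gen 2; the successor piece named in gen 0's HANDOFF).  File 3c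
(`B9Thm31SiteCoerciveReg335Y.trIP_deltaPrimeAY_parSymY_ge`, p589008) proved the UNIFORM COERCIVITY of def-Y's letter `Δ′_a(U) = deltaPrimeAY i (parSymY i) U`
on def-Y's typed class (3.35): `(1∕8)·(L^k)⁻²·⟨Φ, Φ⟩ ≤ Re⟨Φ, Δ′_a(U)Φ⟩` whenever `c·M·α₀·(d+1) ≤ 1∕16`.  THIS FILE turns that form bound into the statements
about the LETTER OF RECORD `G′(U) = GpY i (parSymY i) U` (def-Y's `Ring.inverse`, the genuine two-sided inverse by dag-n06-j's `isUnit_deltaPrimeAY_parSymY`)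
that Thm 3.1 ∕ (3.25) ∕ Thm 3.11 use at the `L²` level: (i) the operator-norm bound `‖G′(U)Ψ‖² ≤ (8L^{2k})²‖Ψ‖²`; (ii) the form bound `⟨Ψ, G′(U)Ψ⟩ ≤
8L^{2k}‖Ψ‖²`; (iii) the transported coercivity `(1∕8)L^{−2k}‖G′Ψ‖² ≤ ⟨Ψ, G′Ψ⟩` and its level-weighted form; and — with NO smallness, at every unitary-valued
background — (iv) the UPPER form bound of (3.24) `⟨Φ, Δ′_a(U)Φ⟩ ≤ (4(d+1)+1)·⟨Φ, Φ⟩` and hence (v) the LOWER form bound `‖Ψ‖² ≤ (4(d+1)+1)·⟨Ψ, G′(U)Ψ⟩`.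
Together: `(4(d+1)+1)⁻¹ ≤ G′(U) ≤ 8L^{2k}` as forms on the class, constants free of the member, the volume, `k`, `N` and `U` — the `L²` shadow of (3.42)
for `G′` (the exponential DECAY of (3.42) is NOT proved here).

WHAT IS PROVED (sorry-free; 0 `def`; no inequality of [B9] asserted as a hypothesis-free fact beyond what is proved).
* §1 the weighted trace pairing (generic `S → M_N(ℂ)`, weight `w > 0`): ★ `abs_trIP_le` (Cauchy–Schwarz `|⟨Φ, Ψ⟩_w| ≤ ‖Φ‖_w‖Ψ‖_w`, via dag-n06-j's
  orthonormal coordinates `realify311`), `trIP_sq_le` (the pairing's algebra is dag-n06-i's `B9Eq3132CoerciveVariational.trIP_sub_right ∕ trIP_smul_right` and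
  `B9Ineq349SiteAdjoint.trIP_comm`, imported).
* §2 Lax–Milgram bookkeeping (generic): for `m > 0` and `m‖Φ‖² ≤ ⟨Φ, TΦ⟩` for all `Φ`: `posDefTr_of_coercive`, `isUnit_of_coercive`, ★ `trIP_self_le_of_coercive`
  (`m²‖Φ‖² ≤ ‖TΦ‖²`), ★ `trIP_ringInverse_self_le` (`m²‖T⁻¹Ψ‖² ≤ ‖Ψ‖²`), ★ `trIP_ringInverse_le` (`m⟨Ψ, T⁻¹Ψ⟩ ≤ ‖Ψ‖²`), `trIP_ringInverse_ge_self`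
  (`m‖T⁻¹Ψ‖² ≤ ⟨Ψ, T⁻¹Ψ⟩`); for a symmetric `T` with `0 ≤ ⟨Φ, TΦ⟩ ≤ M‖Φ‖²`: ★ `trIP_map_self_le_of_symm` (`‖TΦ‖² ≤ M⟨Φ, TΦ⟩`, by the identity
  `M(M·T − T²) = T(M−T)T + (M−T)T(M−T)`), ★ `trIP_self_le_ringInverse_of_symm` (`‖Ψ‖² ≤ M⟨Ψ, T⁻¹Ψ⟩` for a unit `T`).
* §3 the UPPER form bound of (3.24) at a `G`-valued background, `G ≤ U(N)` (no smallness): `trIP_cdS_self_le` (`‖∇_{U,μ}Φ‖² ≤ 4‖Φ‖²`: unitary transporters are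
  HS-contractions, the shift is a permutation), `levC_mul_hs_blkSumY_le` (`levC_s·HS(Σ_{z∈s}R(·)Φ z) ≤ Σ_{z∈s}HS(Φ z)`: Cauchy–Schwarz over the block,
  `levC_s·|s| = a_s·n_s⁻² ≤ 1`), ★★ `trIP_deltaPrimeAY_le` (`⟨Φ, Δ′_a(U)Φ⟩ ≤ (4(d+1)+1)·⟨Φ, Φ⟩` on any inverse-symmetric `G`-valued table), ★★
  `trIP_deltaPrimeAY_parSymY_le` (the same at def-Y's `parSymY`).
* §4 ON THE CLASS `(bg9K (M_N ℂ) G i).Reg335 c α₀`, `G ≤ U(N)`, `N ≥ 1`, `0 ≤ c·M·α₀`, `c·M·α₀·(d+1) ≤ 1∕16`: ★★★ `trIP_GpY_parSymY_self_le`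
  (`‖G′(U)Ψ‖² ≤ (8·(L^k)²)²·‖Ψ‖²`), ★★ `trIP_GpY_parSymY_le` (`⟨Ψ, G′(U)Ψ⟩ ≤ 8·(L^k)²·‖Ψ‖²`), ★★ `trIP_GpY_parSymY_ge_self`
  (`(1∕8)(L^k)⁻²‖G′Ψ‖² ≤ ⟨Ψ, G′Ψ⟩`), ★ `levelMass_GpY_parSymY_le` (`(1∕8)Σ_z (L^{lev z})⁻²HS((G′Ψ) z) ≤ ⟨Ψ, G′Ψ⟩`); and at EVERY `G`-valued background:
  ★★ `trIP_self_le_GpY_parSymY` (`‖Ψ‖² ≤ (4(d+1)+1)·⟨Ψ, G′(U)Ψ⟩`).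
MODEL ∕ DECLARED READINGS.  (M1)–(M3) as file 3c: def-Y's letters on NODE 00's box chart, fibre `M_N(ℂ)`, the weight-`1` trace pairing `trIP 1` of dag-n06-j
(print's `η^d`-weighted scalar products up to the common factor), masses in LATTICE units of the member (`(L^k)²` is print's `(L^kη)²·η⁻²`); the threshold
`c·M·α₀·(d+1) ≤ 1∕16` is file 3c's witness for print's «α₀ sufficiently small».  (M4) «operator norm» = the `L²(trIP 1)`-operator norm, stated as the form
inequalities above (no `‖·‖` on `End` is introduced).  NOT HERE: the decay half of Thm 3.1 ((3.42)–(3.47) for `G′`), the bond sector `Δ_a(U)` (the N06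
certificate's row-17 binder `hΔA`), anything at `U ∉` the class beyond §3∕(v).  NON-VACUITY (the cell's A6 rule): as file 3c — `U ≡ 1 ∈ Reg335 c α₀`
(`B9BackgroundsKLevelV1.reg335_one`) and every pure gauge lies in the class; §3 and (v) hold at every unitary-valued background.
HONEST SCOPE.  Finite-dimensional consequences of one proved form bound, constants explicit; NOT a node discharge, NOT summit progress; count-neutral;
nothing continuum ∕ OS ∕ mass gap ∕ Clay.  NEW file importing file 3c and dag-n06-i's `B9Eq3132CoerciveVariational` (pairing algebra) only; nothing landed is modified.  Net new unproved facts: 0.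
-/

noncomputable section

namespace Literature.MathematicalPhysics.QuantumFieldTheory.Balaban1983to89.B9Thm31SiteGpBoundsReg335Y

open Literature.MathematicalPhysics.QuantumFieldTheory.Balaban1983to89
open Node00 B6KLevelCensusIndexV1 B6Geom246MultiLevelBox B6MultiLevelBoxOperator B6MultiLevelTorusOperator B6GlobalChartV1 B9BackgroundsKLevelV1
  B9Eq39Adjoint B9Thm311ReadingCoords B9Thm311DeltaPrimePos B9Ineq369CurvatureSmallAtLettersY B9Thm31SiteCoerciveGaugeBlockY
  B9Thm31SiteCoerciveReg335Y
open Literature.MathematicalPhysics.QuantumFieldTheory.Balaban1983to89.B9Ineq349SiteAdjoint (trIP_comm)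
open Literature.MathematicalPhysics.QuantumFieldTheory.Balaban1983to89.B9Eq3132CoerciveVariational (trIP_sub_right trIP_smul_right)
open Literature.MathematicalPhysics.QuantumFieldTheory.Balaban1983to89.B9Thm311SymmAtRecordV4 (symm0_parSymY)
open Literature.MathematicalPhysics.QuantumFieldTheory.Balaban1983to89.B4Lower18 (card_filter_rblk)
open scoped Matrix Matrix.Norms.L2Operator

/-! ## §1 The weighted trace pairing: Cauchy–Schwarz -/

section Pairing

variable {S : Type} [Fintype S] {N : ℕ}

/-- ★ **CAUCHY–SCHWARZ FOR THE WEIGHTED TRACE PAIRING**: `|⟨Φ, Ψ⟩_w| ≤ ‖Φ‖_w·‖Ψ‖_w` (`w > 0`; the pairing is a real inner product in dag-n06-j's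
orthonormal coordinates `realify311`). [cite: Balaban1985BackgroundPropagators, p.393 (scalar products); Balaban1984PropagatorsII, (2.69) p.235] -/
theorem abs_trIP_le (w : S → ℝ) (hw : ∀ s, 0 < w s) (Φ Ψ : S → Matrix (Fin N) (Fin N) ℂ) :
    |trIP w Φ Ψ| ≤ Real.sqrt (trIP w Φ Φ) * Real.sqrt (trIP w Ψ Ψ) := by
  rw [← inner_realify311 (hw := hw), ← norm_sq_realify311 (hw := hw) Φ, ← norm_sq_realify311 (hw := hw) Ψ,
    Real.sqrt_sq (norm_nonneg _), Real.sqrt_sq (norm_nonneg _)]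
  exact abs_real_inner_le_norm _ _

/-- Cauchy–Schwarz, squared: `⟨Φ, Ψ⟩_w² ≤ ‖Φ‖²_w·‖Ψ‖²_w`. [cite: Balaban1985BackgroundPropagators, p.393 (scalar products), bookkeeping] -/
theorem trIP_sq_le (w : S → ℝ) (hw : ∀ s, 0 < w s) (Φ Ψ : S → Matrix (Fin N) (Fin N) ℂ) :
    trIP w Φ Ψ ^ 2 ≤ trIP w Φ Φ * trIP w Ψ Ψ := by
  have h := abs_trIP_le w hw Φ Ψ
  have ha := trIP_self_nonneg w hw Φ
  have hb := trIP_self_nonneg w hw Ψ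
  calc trIP w Φ Ψ ^ 2 = |trIP w Φ Ψ| ^ 2 := (sq_abs _).symm
    _ ≤ (Real.sqrt (trIP w Φ Φ) * Real.sqrt (trIP w Ψ Ψ)) ^ 2 := pow_le_pow_left₀ (abs_nonneg _) h 2
    _ = trIP w Φ Φ * trIP w Ψ Ψ := by rw [mul_pow, Real.sq_sqrt ha, Real.sq_sqrt hb]

end Pairing

/-! ## §2 Lax–Milgram bookkeeping: a coercive operator, its inverse; a bounded symmetric positive operator, its inverse -/

section Coercive

variable {S : Type} [Fintype S] {N : ℕ} {w : S → ℝ} (hw : ∀ s, 0 < w s)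
  {T : (S → Matrix (Fin N) (Fin N) ℂ) →ₗ[ℂ] (S → Matrix (Fin N) (Fin N) ℂ)} {m : ℝ} (hm : 0 < m)
  (hco : ∀ Φ, m * trIP w Φ Φ ≤ trIP w Φ (T Φ))
include hw hm hco

/-- a coercive operator (`m‖Φ‖² ≤ ⟨Φ, TΦ⟩`, `m > 0`) is positive definite. [cite: Balaban1985BackgroundPropagators, (3.25) p.395 («Δ′_a is positive»), Thm 3.11 p.416] -/
theorem posDefTr_of_coercive : PosDefTr w T :=
  fun Φ hΦ => lt_of_lt_of_le (mul_pos hm (trIP_self_pos w hw hΦ)) (hco Φ)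

/-- … hence a unit: its `Ring.inverse` is the genuine two-sided inverse. [cite: Balaban1985BackgroundPropagators, (3.25) p.395 («G′ = (Δ′_a)⁻¹»)] -/
theorem isUnit_of_coercive : IsUnit T :=
  isUnit_of_posDefTr (posDefTr_of_coercive hw hm hco)

/-- ★ LAX–MILGRAM: `m‖Φ‖² ≤ ⟨Φ, TΦ⟩ ≤ ‖Φ‖·‖TΦ‖`, so `m²‖Φ‖² ≤ ‖TΦ‖²`. [cite: Balaban1985BackgroundPropagators, Thm 3.1 p.397, (3.25) p.395] -/
theorem trIP_self_le_of_coercive (Φ : S → Matrix (Fin N) (Fin N) ℂ) : m ^ 2 * trIP w Φ Φ ≤ trIP w (T Φ) (T Φ) := by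
  have ha : 0 ≤ trIP w Φ Φ := trIP_self_nonneg w hw Φ
  have hb : 0 ≤ trIP w (T Φ) (T Φ) := trIP_self_nonneg w hw _
  have hx : m * trIP w Φ Φ ≤ trIP w Φ (T Φ) := hco Φ
  have hx2 : trIP w Φ (T Φ) ^ 2 ≤ trIP w Φ Φ * trIP w (T Φ) (T Φ) := trIP_sq_le w hw Φ (T Φ)
  have hma : 0 ≤ m * trIP w Φ Φ := mul_nonneg hm.le ha
  have h3 : (m * trIP w Φ Φ) ^ 2 ≤ trIP w Φ Φ * trIP w (T Φ) (T Φ) := le_trans (pow_le_pow_left₀ hma hx 2) hx2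
  rcases ha.eq_or_lt with h0 | hpos
  · rw [← h0, mul_zero]; exact hb
  · have h4 : m ^ 2 * trIP w Φ Φ * trIP w Φ Φ ≤ trIP w (T Φ) (T Φ) * trIP w Φ Φ := by nlinarith
    exact le_of_mul_le_mul_right h4 hpos

/-- ★ THE INVERSE IS BOUNDED: `m²‖T⁻¹Ψ‖² ≤ ‖Ψ‖²` («‖G′‖ ≤ m⁻¹»). [cite: Balaban1985BackgroundPropagators, Thm 3.1 p.397, (3.25) p.395] -/
theorem trIP_ringInverse_self_le (Ψ : S → Matrix (Fin N) (Fin N) ℂ) :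
    m ^ 2 * trIP w (Ring.inverse T Ψ) (Ring.inverse T Ψ) ≤ trIP w Ψ Ψ := by
  have h := trIP_self_le_of_coercive hw hm hco (Ring.inverse T Ψ)
  rwa [apply_inverse_of_isUnit (isUnit_of_coercive hw hm hco)] at h

/-- the coercivity, transported to the inverse: `m‖T⁻¹Ψ‖² ≤ ⟨Ψ, T⁻¹Ψ⟩` (in particular `T⁻¹` is positive). [cite: Balaban1985BackgroundPropagators, (3.25) p.395 («positivity of the operators G′»)] -/
theorem trIP_ringInverse_ge_self (Ψ : S → Matrix (Fin N) (Fin N) ℂ) :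
    m * trIP w (Ring.inverse T Ψ) (Ring.inverse T Ψ) ≤ trIP w Ψ (Ring.inverse T Ψ) := by
  have h := hco (Ring.inverse T Ψ)
  rwa [apply_inverse_of_isUnit (isUnit_of_coercive hw hm hco), trIP_comm w (Ring.inverse T Ψ) Ψ] at h

/-- ★ THE INVERSE AS A FORM: `m⟨Ψ, T⁻¹Ψ⟩ ≤ ‖Ψ‖²` («G′ ≤ m⁻¹»). [cite: Balaban1985BackgroundPropagators, Thm 3.1 p.397, (3.25) p.395] -/
theorem trIP_ringInverse_le (Ψ : S → Matrix (Fin N) (Fin N) ℂ) : m * trIP w Ψ (Ring.inverse T Ψ) ≤ trIP w Ψ Ψ := by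
  have hq : 0 ≤ trIP w Ψ Ψ := trIP_self_nonneg w hw Ψ
  have hp : 0 ≤ trIP w (Ring.inverse T Ψ) (Ring.inverse T Ψ) := trIP_self_nonneg w hw _
  have hx0 : 0 ≤ trIP w Ψ (Ring.inverse T Ψ) :=
    le_trans (mul_nonneg hm.le hp) (trIP_ringInverse_ge_self hw hm hco Ψ)
  have h1 := trIP_ringInverse_self_le hw hm hco Ψ
  have h2 : trIP w Ψ (Ring.inverse T Ψ) ^ 2 ≤ trIP w Ψ Ψ * trIP w (Ring.inverse T Ψ) (Ring.inverse T Ψ) := trIP_sq_le w hw _ _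
  have h3 : (m * trIP w Ψ (Ring.inverse T Ψ)) ^ 2 ≤ (trIP w Ψ Ψ) ^ 2 := by
    calc (m * trIP w Ψ (Ring.inverse T Ψ)) ^ 2 = m ^ 2 * trIP w Ψ (Ring.inverse T Ψ) ^ 2 := by ring
      _ ≤ m ^ 2 * (trIP w Ψ Ψ * trIP w (Ring.inverse T Ψ) (Ring.inverse T Ψ)) := mul_le_mul_of_nonneg_left h2 (sq_nonneg m)
      _ = trIP w Ψ Ψ * (m ^ 2 * trIP w (Ring.inverse T Ψ) (Ring.inverse T Ψ)) := by ring
      _ ≤ trIP w Ψ Ψ * trIP w Ψ Ψ := mul_le_mul_of_nonneg_left h1 hq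
      _ = trIP w Ψ Ψ ^ 2 := (sq _).symm
  exact (pow_le_pow_iff_left₀ (mul_nonneg hm.le hx0) hq two_ne_zero).1 h3

end Coercive

section Symmetric

variable {S : Type} [Fintype S] {N : ℕ} {w : S → ℝ}
  {T : (S → Matrix (Fin N) (Fin N) ℂ) →ₗ[ℂ] (S → Matrix (Fin N) (Fin N) ℂ)} (hsy : IsSymmTr w T)
  (hpos : ∀ Φ, 0 ≤ trIP w Φ (T Φ)) {M : ℝ} (hM : 0 < M) (hup : ∀ Φ, trIP w Φ (T Φ) ≤ M * trIP w Φ Φ)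
include hsy hpos hM hup

/-- ★ A BOUNDED SYMMETRIC POSITIVE OPERATOR: `0 ≤ T ≤ M` as forms and `T` symmetric ⇒ `‖TΦ‖² ≤ M⟨Φ, TΦ⟩` — by the identity
`M·(M·T − T²) = T(M − T)T + (M − T)T(M − T)` whose two summands are positive forms. [cite: Balaban1985BackgroundPropagators, Thm 3.11 p.416 («symmetric … positive definite»), bookkeeping] -/
theorem trIP_map_self_le_of_symm (Φ : S → Matrix (Fin N) (Fin N) ℂ) : trIP w (T Φ) (T Φ) ≤ M * trIP w Φ (T Φ) := by
  -- `u = TΦ`, `v = MΦ − TΦ`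
  have h1 : trIP w (T Φ) (T (T Φ)) ≤ M * trIP w (T Φ) (T Φ) := hup (T Φ)
  have h2 : 0 ≤ trIP w (M • Φ - T Φ) (T (M • Φ - T Φ)) := hpos _
  have hs1 : trIP w Φ (T (T Φ)) = trIP w (T Φ) (T Φ) := (hsy Φ (T Φ)).symm
  have hexp : trIP w (M • Φ - T Φ) (T (M • Φ - T Φ))
      = M * (M * trIP w Φ (T Φ) - trIP w (T Φ) (T Φ)) - (M * trIP w (T Φ) (T Φ) - trIP w (T Φ) (T (T Φ))) := by
    rw [map_sub, LinearMap.map_smul_of_tower, trIP_sub_right, trIP_smul_right, trIP_comm w (M • Φ - T Φ) (T Φ), trIP_comm w (M • Φ - T Φ) (T (T Φ)),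
      trIP_sub_right, trIP_sub_right, trIP_smul_right, trIP_smul_right, trIP_comm w (T Φ) Φ, trIP_comm w (T (T Φ)) Φ, hs1, trIP_comm w (T (T Φ)) (T Φ)]
  rw [hexp] at h2
  nlinarith

/-- ★ … HENCE THE INVERSE IS BOUNDED BELOW: for a unit `T` with `0 ≤ T ≤ M`, `T` symmetric: `‖Ψ‖² ≤ M⟨Ψ, T⁻¹Ψ⟩` («G′ ≥ M⁻¹»).
[cite: Balaban1985BackgroundPropagators, Thm 3.11 p.416, (3.25) p.395] -/
theorem trIP_self_le_ringInverse_of_symm (hT : IsUnit T) (Ψ : S → Matrix (Fin N) (Fin N) ℂ) :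
    trIP w Ψ Ψ ≤ M * trIP w Ψ (Ring.inverse T Ψ) := by
  have h := trIP_map_self_le_of_symm hsy hpos hM hup (Ring.inverse T Ψ)
  rwa [apply_inverse_of_isUnit hT, trIP_comm w (Ring.inverse T Ψ) Ψ] at h

end Symmetric

/-! ## §3 The upper form bound of (3.24) at a unitary-valued background (no smallness) -/

section Upper

variable {d ℓ : ℕ} {hd : 1 ≤ d + 1} {hL : Odd (ℓ + 1) ∧ 1 < ℓ + 1} {b₀ b₁ : ℝ}
variable (i : KIdx d ℓ hd hL b₀ b₁) {N : ℕ} {G : Subgroup (Matrix (Fin N) (Fin N) ℂ)ˣ}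

/-- CAUCHY–SCHWARZ for `HS` of a finite sum: `HS(Σ_{z∈B} E z) ≤ |B|·Σ_{z∈B} HS(E z)`. [folklore] -/
private theorem hs_finsetSum_le_card_mul {ι : Type} (B : Finset ι) (E : ι → Matrix (Fin N) (Fin N) ℂ) :
    ∑ a, ∑ b, ‖(∑ z ∈ B, E z) a b‖ ^ 2 ≤ (B.card : ℝ) * ∑ z ∈ B, ∑ a, ∑ b, ‖E z a b‖ ^ 2 := by
  calc ∑ a, ∑ b, ‖(∑ z ∈ B, E z) a b‖ ^ 2 ≤ ∑ a, ∑ b, (∑ z ∈ B, ‖E z a b‖) ^ 2 := by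
        refine Finset.sum_le_sum fun a _ => Finset.sum_le_sum fun b _ => ?_
        rw [Matrix.sum_apply]
        exact pow_le_pow_left₀ (norm_nonneg _) (norm_sum_le _ _) 2
    _ ≤ ∑ a, ∑ b, ((B.card : ℝ) * ∑ z ∈ B, ‖E z a b‖ ^ 2) :=
        Finset.sum_le_sum fun a _ => Finset.sum_le_sum fun b _ => sq_sum_le_card_mul_sum_sq
    _ = (B.card : ℝ) * ∑ a, ∑ b, ∑ z ∈ B, ‖E z a b‖ ^ 2 := by simp only [Finset.mul_sum]
    _ = (B.card : ℝ) * ∑ z ∈ B, ∑ a, ∑ b, ‖E z a b‖ ^ 2 := by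
        congr 1
        rw [Finset.sum_congr rfl fun a _ => Finset.sum_comm, Finset.sum_comm]

/-- ONE DIRECTION OF THE COVARIANT GRADIENT IS `L²`-BOUNDED BY `2`: `‖∇_{U,μ}Φ‖²₁ ≤ 4‖Φ‖²₁` at a `G`-valued background, `G ≤ U(N)`
(`HS(R(V)X − Y) ≤ 2HS(X) + 2HS(Y)` for unitary `V`; the shift is a permutation of the sites). [cite: Balaban1985BackgroundPropagators, (3.3) p.390, (3.23)–(3.24) p.394] -/
theorem trIP_cdS_self_le (hG : G ≤ B7Prop2Explicit.unitaryUnits (Matrix (Fin N) (Fin N) ℂ)) {U : CfgY (Matrix (Fin N) (Fin N) ℂ) i}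
    (hU : ∀ μ x, U μ x ∈ G) (μ : Fin (d + 1)) (Φ : SiteY i → Matrix (Fin N) (Fin N) ℂ) :
    trIP (fun _ => (1 : ℝ)) (cdS i U μ Φ) (cdS i U μ Φ) ≤ 4 * trIP (fun _ => (1 : ℝ)) Φ Φ := by
  rw [trIP_one_self_eq, trIP_one_self_eq]
  have hper : ∀ z : SiteY i, ∑ a, ∑ b, ‖cdS i U μ Φ z a b‖ ^ 2
      ≤ 2 * ∑ a, ∑ b, ‖Φ (shiftY i μ z) a b‖ ^ 2 + 2 * ∑ a, ∑ b, ‖Φ z a b‖ ^ 2 := by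
    intro z
    have hform : cdS i U μ Φ z = R (UboxY i U μ z) (Φ (shiftY i μ z)) - Φ z := rfl
    rw [hform]
    have hV := contractive_of_mem_unitary (V := UboxY i U μ z) (hG (hU μ _))
    have h1 := hs_sub_le (R (UboxY i U μ z) (Φ (shiftY i μ z))) (Φ z)
    have h2 := hs_R_le hV (Φ (shiftY i μ z))
    linarith
  calc ∑ z, ∑ a, ∑ b, ‖cdS i U μ Φ z a b‖ ^ 2
      ≤ ∑ z, (2 * ∑ a, ∑ b, ‖Φ (shiftY i μ z) a b‖ ^ 2 + 2 * ∑ a, ∑ b, ‖Φ z a b‖ ^ 2) := Finset.sum_le_sum fun z _ => hper z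
    _ = 2 * ∑ z, ∑ a, ∑ b, ‖Φ (shiftY i μ z) a b‖ ^ 2 + 2 * ∑ z, ∑ a, ∑ b, ‖Φ z a b‖ ^ 2 := by
        rw [Finset.sum_add_distrib, Finset.mul_sum, Finset.mul_sum]
    _ = 4 * ∑ z, ∑ a, ∑ b, ‖Φ z a b‖ ^ 2 := by
        rw [Equiv.sum_comp (shiftY i μ) (fun z => ∑ a, ∑ b, ‖Φ z a b‖ ^ 2)]
        ring

/-- ONE BLOCK OF THE AVERAGING FORM IS BOUNDED BY THE BLOCK MASS: for `s ∈ 𝔅` (side `n = L^{j(s)}`) and a `G`-valued table, `G ≤ U(N)`,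
`levC_s·HS(Σ_{z∈s} R(U(Γ_{c_s,z}))Φ(z)) ≤ Σ_{z∈s} HS(Φ z)` — Cauchy–Schwarz over the `n^{d+1}` sites and `levC_s·n^{d+1} = a_s·n⁻² ≤ 1`.
[cite: Balaban1985BackgroundPropagators, (3.19) p.393, (3.24) p.394; Balaban1984PropagatorsII, (2.14) p.225] -/
theorem levC_mul_hs_blkSumY_le (hG : G ≤ B7Prop2Explicit.unitaryUnits (Matrix (Fin N) (Fin N) ℂ))
    (par : SiteParY (Matrix (Fin N) (Fin N) ℂ) i) (U : CfgY (Matrix (Fin N) (Fin N) ℂ) i) (hpar : ∀ z w : SiteY i, par U z w ∈ G)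
    (Φ : SiteY i → Matrix (Fin N) (Fin N) ℂ) (s : BlkY i) :
    levC d ℓ (aPrinted ℓ 1) s.1.1 * ∑ a, ∑ b, ‖blkSumY i par U Φ s a b‖ ^ 2
      ≤ ∑ z ∈ Finset.univ.filter (fun z : SiteY i => blkOf i.D.toDomains z = s), ∑ a, ∑ b, ‖Φ z a b‖ ^ 2 := by
  set B := Finset.univ.filter (fun z : SiteY i => blkOf i.D.toDomains z = s) with hB
  have hκ : 0 ≤ levC d ℓ (aPrinted ℓ 1) s.1.1 := (levC_blk_pos i s).le
  have hcard : (B.card : ℝ) = (((ℓ + 1) ^ s.1.1 : ℕ) : ℝ) ^ (d + 1) := by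
    rw [hB, ← filter_rblk_eq_filter_blkOf i s,
      card_filter_rblk (le_trans one_le_two (two_le_side i s)) (isBlockUnion_XB i (scale_bounds i.D.toDomains s).2)]
    push_cast; ring
  -- Cauchy–Schwarz over the block, unitary transporters dropped
  have h1 : ∑ a, ∑ b, ‖blkSumY i par U Φ s a b‖ ^ 2 ≤ (B.card : ℝ) * ∑ z ∈ B, ∑ a, ∑ b, ‖Φ z a b‖ ^ 2 := by
    have h := hs_finsetSum_le_card_mul B (fun z => R (par U (blkCornerY i s) z) (Φ z))
    refine le_trans h (mul_le_mul_of_nonneg_left (Finset.sum_le_sum fun z _ => ?_) (Nat.cast_nonneg _))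
    exact hs_R_le (contractive_of_mem_unitary (V := par U (blkCornerY i s) z) (hG (hpar _ _))) (Φ z)
  have hm0 : 0 ≤ ∑ z ∈ B, ∑ a, ∑ b, ‖Φ z a b‖ ^ 2 := Finset.sum_nonneg fun _ _ => hs_nonneg _
  -- the coefficient `levC_s·n^{d+1} = a_s·n⁻² ≤ 1`
  have hcoef : levC d ℓ (aPrinted ℓ 1) s.1.1 * (B.card : ℝ) ≤ 1 := by
    rw [hcard, levC_mul_side_pow i s]
    have ha1 : aPrinted ℓ 1 s.1.1 ≤ 1 := B6Prop23KLevelTorusCensus.aPrinted_le_one (by have := i.hℓ; omega) _ (one_le_level i s)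
    have ha0 : 0 ≤ aPrinted ℓ 1 s.1.1 := le_trans (by norm_num) (aPrinted_ge_half i s)
    have hn2 : (2 : ℝ) ≤ (((ℓ + 1) ^ s.1.1 : ℕ) : ℝ) := by exact_mod_cast two_le_side i s
    have hinv : ((((ℓ + 1) ^ s.1.1 : ℕ) : ℝ) ^ 2)⁻¹ ≤ 1 := inv_le_one_of_one_le₀ (by nlinarith)
    have hinv0 : 0 ≤ ((((ℓ + 1) ^ s.1.1 : ℕ) : ℝ) ^ 2)⁻¹ := inv_nonneg.2 (by positivity)
    nlinarith
  calc levC d ℓ (aPrinted ℓ 1) s.1.1 * ∑ a, ∑ b, ‖blkSumY i par U Φ s a b‖ ^ 2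
      ≤ levC d ℓ (aPrinted ℓ 1) s.1.1 * ((B.card : ℝ) * ∑ z ∈ B, ∑ a, ∑ b, ‖Φ z a b‖ ^ 2) := mul_le_mul_of_nonneg_left h1 hκ
    _ = (levC d ℓ (aPrinted ℓ 1) s.1.1 * (B.card : ℝ)) * ∑ z ∈ B, ∑ a, ∑ b, ‖Φ z a b‖ ^ 2 := by ring
    _ ≤ 1 * ∑ z ∈ B, ∑ a, ∑ b, ‖Φ z a b‖ ^ 2 := mul_le_mul_of_nonneg_right hcoef hm0
    _ = _ := one_mul _

/-- ★★ **THE UPPER FORM BOUND OF (3.24)** on an inverse-symmetric `G`-valued transporter table at a `G`-valued background, `G ≤ U(N)` — NO smallness: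
`⟨Φ, Δ′_a(U)Φ⟩₁ ≤ (4(d+1) + 1)·⟨Φ, Φ⟩₁` (gradient part `≤ 4` per direction, averaging part `≤` the mass). [cite: Balaban1985BackgroundPropagators, (3.23)–(3.24) pp.394–395, Thm 3.11 p.416] -/
theorem trIP_deltaPrimeAY_le (hG : G ≤ B7Prop2Explicit.unitaryUnits (Matrix (Fin N) (Fin N) ℂ))
    (par : SiteParY (Matrix (Fin N) (Fin N) ℂ) i) (U : CfgY (Matrix (Fin N) (Fin N) ℂ) i) (hinv : ∀ z z' : SiteY i, par U z z' = (par U z' z)⁻¹)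
    (hpar : ∀ z w : SiteY i, par U z w ∈ G) (hU : ∀ μ x, U μ x ∈ G) (Φ : SiteY i → Matrix (Fin N) (Fin N) ℂ) :
    trIP (fun _ => (1 : ℝ)) Φ (deltaPrimeAY i par U Φ) ≤ (4 * ((d : ℝ) + 1) + 1) * trIP (fun _ => (1 : ℝ)) Φ Φ := by
  rw [trIP_deltaPrimeAY_eq i hG par U hinv hpar hU Φ]
  have hgrad : ∑ μ : Fin (d + 1), trIP (fun _ => (1 : ℝ)) (cdS i U μ Φ) (cdS i U μ Φ) ≤ ((d : ℝ) + 1) * (4 * trIP (fun _ => (1 : ℝ)) Φ Φ) := by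
    calc ∑ μ : Fin (d + 1), trIP (fun _ => (1 : ℝ)) (cdS i U μ Φ) (cdS i U μ Φ)
        ≤ ∑ _μ : Fin (d + 1), 4 * trIP (fun _ => (1 : ℝ)) Φ Φ := Finset.sum_le_sum fun μ _ => trIP_cdS_self_le i hG hU μ Φ
      _ = ((d : ℝ) + 1) * (4 * trIP (fun _ => (1 : ℝ)) Φ Φ) := by
          rw [Finset.sum_const, Finset.card_univ, Fintype.card_fin, nsmul_eq_mul]; push_cast; ring
  have hblk : ∑ s : BlkY i, levC d ℓ (aPrinted ℓ 1) s.1.1 * (Matrix.trace ((blkSumY i par U Φ s)ᴴ * blkSumY i par U Φ s)).re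
      ≤ trIP (fun _ => (1 : ℝ)) Φ Φ := by
    calc ∑ s : BlkY i, levC d ℓ (aPrinted ℓ 1) s.1.1 * (Matrix.trace ((blkSumY i par U Φ s)ᴴ * blkSumY i par U Φ s)).re
        = ∑ s : BlkY i, levC d ℓ (aPrinted ℓ 1) s.1.1 * ∑ a, ∑ b, ‖blkSumY i par U Φ s a b‖ ^ 2 :=
          Finset.sum_congr rfl fun s _ => by rw [hs_eq_re_trace]
      _ ≤ ∑ s : BlkY i, ∑ z ∈ Finset.univ.filter (fun z : SiteY i => blkOf i.D.toDomains z = s), ∑ a, ∑ b, ‖Φ z a b‖ ^ 2 :=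
          Finset.sum_le_sum fun s _ => levC_mul_hs_blkSumY_le i hG par U hpar Φ s
      _ = ∑ z : SiteY i, ∑ a, ∑ b, ‖Φ z a b‖ ^ 2 :=
          Finset.sum_fiberwise Finset.univ (fun z : SiteY i => blkOf i.D.toDomains z) (fun z => ∑ a, ∑ b, ‖Φ z a b‖ ^ 2)
      _ = trIP (fun _ => (1 : ℝ)) Φ Φ := (trIP_one_self_eq Φ).symm
  have h0 : 0 ≤ trIP (fun _ => (1 : ℝ)) Φ Φ := trIP_self_nonneg _ (fun _ => one_pos) Φ
  nlinarith

/-- ★★ **THE UPPER FORM BOUND OF (3.24) AT def-Y's LETTER**: `⟨Φ, deltaPrimeAY i (parSymY i) U Φ⟩₁ ≤ (4(d+1) + 1)·⟨Φ, Φ⟩₁` for every `G`-valued `U`,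
`G ≤ U(N)` (no smallness). [cite: Balaban1985BackgroundPropagators, (3.24) pp.394–395, Thm 3.11 p.416] -/
theorem trIP_deltaPrimeAY_parSymY_le (hG : G ≤ B7Prop2Explicit.unitaryUnits (Matrix (Fin N) (Fin N) ℂ)) {U : CfgY (Matrix (Fin N) (Fin N) ℂ) i}
    (hU : ∀ μ x, U μ x ∈ G) (Φ : SiteY i → Matrix (Fin N) (Fin N) ℂ) :
    trIP (fun _ => (1 : ℝ)) Φ (deltaPrimeAY i (parSymY i) U Φ) ≤ (4 * ((d : ℝ) + 1) + 1) * trIP (fun _ => (1 : ℝ)) Φ Φ :=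
  trIP_deltaPrimeAY_le i hG (parSymY i) U (parSymY_inv_symm U) (fun z w => parSymY_mem i hU z w) hU Φ

end Upper

/-! ## §4 `G′(U)` on the class (3.35): the two-sided operator bounds -/

section Main

variable {d ℓ : ℕ} {hd : 1 ≤ d + 1} {hL : Odd (ℓ + 1) ∧ 1 < ℓ + 1} {b₀ b₁ : ℝ}
variable (i : KIdx d ℓ hd hL b₀ b₁) {N : ℕ} {G : Subgroup (Matrix (Fin N) (Fin N) ℂ)ˣ}

/-- the coercivity constant of file 3c is positive. [cite: Balaban1985BackgroundPropagators, Thm 3.1 p.397, bookkeeping] -/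
theorem coerciveConst_pos : (0 : ℝ) < (1 / 8 : ℝ) * (((((ℓ + 1) ^ i.k : ℕ) : ℝ)) ^ 2)⁻¹ := by
  positivity

/-- ★★★ **«‖G′(U)‖ ≤ 8L^{2k}» UNIFORMLY ON THE CLASS (3.35)**: for `G ≤ U(N)`, `N ≥ 1`, `0 ≤ c·M·α₀`, `c·M·α₀·(d+1) ≤ 1∕16` and every
`U ∈ (bg9K (M_N ℂ) G i).Reg335 c α₀`: `‖G′(U)Ψ‖²₁ ≤ (8·(L^k)²)²·‖Ψ‖²₁` for every `Ψ` — def-Y's letter `GpY i (parSymY i) U`, constants free of the member, the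
volume, `k`, `N` and `U`. [cite: Balaban1985BackgroundPropagators, Thm 3.1 p.397, (3.25) p.395, Thm 3.11 p.416; Balaban1984PropagatorsII, p.225] -/
theorem trIP_GpY_parSymY_self_le [Nonempty (Fin N)] (hG : G ≤ B7Prop2Explicit.unitaryUnits (Matrix (Fin N) (Fin N) ℂ))
    {U : CfgY (Matrix (Fin N) (Fin N) ℂ) i} {c α₀ : ℝ} (hC0 : 0 ≤ c * (kGeo i).M * α₀) (hC1 : c * (kGeo i).M * α₀ * ((d : ℝ) + 1) ≤ 1 / 16)
    (hreg : (bg9K (Matrix (Fin N) (Fin N) ℂ) G i).Reg335 c α₀ U) (Ψ : SiteY i → Matrix (Fin N) (Fin N) ℂ) :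
    trIP (fun _ => (1 : ℝ)) (GpY i (parSymY i) U Ψ) (GpY i (parSymY i) U Ψ)
      ≤ (8 * ((((ℓ + 1) ^ i.k : ℕ) : ℝ)) ^ 2) ^ 2 * trIP (fun _ => (1 : ℝ)) Ψ Ψ := by
  have h := trIP_ringInverse_self_le (fun _ => one_pos) (coerciveConst_pos i)
    (fun Φ => trIP_deltaPrimeAY_parSymY_ge i hG hC0 hC1 hreg Φ) Ψ
  have hn : (0 : ℝ) < ((((ℓ + 1) ^ i.k : ℕ) : ℝ)) ^ 2 := by positivity
  have hp : 0 ≤ trIP (fun _ => (1 : ℝ)) (GpY i (parSymY i) U Ψ) (GpY i (parSymY i) U Ψ) := trIP_self_nonneg _ (fun _ => one_pos) _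
  have e : ((1 / 8 : ℝ) * (((((ℓ + 1) ^ i.k : ℕ) : ℝ)) ^ 2)⁻¹) ^ 2 * ((8 * ((((ℓ + 1) ^ i.k : ℕ) : ℝ)) ^ 2) ^ 2) = 1 := by
    field_simp
  calc trIP (fun _ => (1 : ℝ)) (GpY i (parSymY i) U Ψ) (GpY i (parSymY i) U Ψ)
      = ((8 * ((((ℓ + 1) ^ i.k : ℕ) : ℝ)) ^ 2) ^ 2) *
          (((1 / 8 : ℝ) * (((((ℓ + 1) ^ i.k : ℕ) : ℝ)) ^ 2)⁻¹) ^ 2 * trIP (fun _ => (1 : ℝ)) (GpY i (parSymY i) U Ψ) (GpY i (parSymY i) U Ψ)) := by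
        rw [← mul_assoc, mul_comm ((8 * _) ^ 2), e, one_mul]
    _ ≤ (8 * ((((ℓ + 1) ^ i.k : ℕ) : ℝ)) ^ 2) ^ 2 * trIP (fun _ => (1 : ℝ)) Ψ Ψ := mul_le_mul_of_nonneg_left h (by positivity)

/-- ★★ **«G′(U) ≤ 8L^{2k}» AS A FORM ON THE CLASS**: `⟨Ψ, G′(U)Ψ⟩₁ ≤ 8·(L^k)²·‖Ψ‖²₁`. [cite: Balaban1985BackgroundPropagators, Thm 3.1 p.397, (3.25) p.395] -/
theorem trIP_GpY_parSymY_le [Nonempty (Fin N)] (hG : G ≤ B7Prop2Explicit.unitaryUnits (Matrix (Fin N) (Fin N) ℂ))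
    {U : CfgY (Matrix (Fin N) (Fin N) ℂ) i} {c α₀ : ℝ} (hC0 : 0 ≤ c * (kGeo i).M * α₀) (hC1 : c * (kGeo i).M * α₀ * ((d : ℝ) + 1) ≤ 1 / 16)
    (hreg : (bg9K (Matrix (Fin N) (Fin N) ℂ) G i).Reg335 c α₀ U) (Ψ : SiteY i → Matrix (Fin N) (Fin N) ℂ) :
    trIP (fun _ => (1 : ℝ)) Ψ (GpY i (parSymY i) U Ψ) ≤ 8 * ((((ℓ + 1) ^ i.k : ℕ) : ℝ)) ^ 2 * trIP (fun _ => (1 : ℝ)) Ψ Ψ := by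
  have h := trIP_ringInverse_le (fun _ => one_pos) (coerciveConst_pos i) (fun Φ => trIP_deltaPrimeAY_parSymY_ge i hG hC0 hC1 hreg Φ) Ψ
  have hn : (0 : ℝ) < ((((ℓ + 1) ^ i.k : ℕ) : ℝ)) ^ 2 := by positivity
  have e : (1 / 8 : ℝ) * (((((ℓ + 1) ^ i.k : ℕ) : ℝ)) ^ 2)⁻¹ * (8 * ((((ℓ + 1) ^ i.k : ℕ) : ℝ)) ^ 2) = 1 := by field_simp
  calc trIP (fun _ => (1 : ℝ)) Ψ (GpY i (parSymY i) U Ψ)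
      = (8 * ((((ℓ + 1) ^ i.k : ℕ) : ℝ)) ^ 2) * ((1 / 8 : ℝ) * (((((ℓ + 1) ^ i.k : ℕ) : ℝ)) ^ 2)⁻¹ * trIP (fun _ => (1 : ℝ)) Ψ (GpY i (parSymY i) U Ψ)) := by
        rw [← mul_assoc, mul_comm (8 * _), e, one_mul]
    _ ≤ 8 * ((((ℓ + 1) ^ i.k : ℕ) : ℝ)) ^ 2 * trIP (fun _ => (1 : ℝ)) Ψ Ψ := mul_le_mul_of_nonneg_left h (by positivity)

/-- ★★ **THE COERCIVITY TRANSPORTED TO `G′(U)`**: `(1∕8)·(L^k)⁻²·‖G′(U)Ψ‖²₁ ≤ ⟨Ψ, G′(U)Ψ⟩₁` on the class. [cite: Balaban1985BackgroundPropagators, Thm 3.1 p.397, (3.25) p.395 («positivity of the operators G′»)] -/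
theorem trIP_GpY_parSymY_ge_self [Nonempty (Fin N)] (hG : G ≤ B7Prop2Explicit.unitaryUnits (Matrix (Fin N) (Fin N) ℂ))
    {U : CfgY (Matrix (Fin N) (Fin N) ℂ) i} {c α₀ : ℝ} (hC0 : 0 ≤ c * (kGeo i).M * α₀) (hC1 : c * (kGeo i).M * α₀ * ((d : ℝ) + 1) ≤ 1 / 16)
    (hreg : (bg9K (Matrix (Fin N) (Fin N) ℂ) G i).Reg335 c α₀ U) (Ψ : SiteY i → Matrix (Fin N) (Fin N) ℂ) :
    (1 / 8 : ℝ) * (((((ℓ + 1) ^ i.k : ℕ) : ℝ)) ^ 2)⁻¹ * trIP (fun _ => (1 : ℝ)) (GpY i (parSymY i) U Ψ) (GpY i (parSymY i) U Ψ)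
      ≤ trIP (fun _ => (1 : ℝ)) Ψ (GpY i (parSymY i) U Ψ) :=
  trIP_ringInverse_ge_self (fun _ => one_pos) (coerciveConst_pos i) (fun Φ => trIP_deltaPrimeAY_parSymY_ge i hG hC0 hC1 hreg Φ) Ψ

/-- ★ **THE LEVEL-WEIGHTED COERCIVITY TRANSPORTED TO `G′(U)`**: `(1∕8)·Σ_z (L^{lev z})⁻²·HS((G′(U)Ψ)(z)) ≤ ⟨Ψ, G′(U)Ψ⟩₁` on the class (the finer levels carry the
larger mass `a_j(Lʲη)⁻²`). [cite: Balaban1985BackgroundPropagators, Thm 3.1 p.397, (3.24) p.394; Balaban1984PropagatorsII, (2.14) p.225] -/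
theorem levelMass_GpY_parSymY_le [Nonempty (Fin N)] (hG : G ≤ B7Prop2Explicit.unitaryUnits (Matrix (Fin N) (Fin N) ℂ))
    {U : CfgY (Matrix (Fin N) (Fin N) ℂ) i} {c α₀ : ℝ} (hC0 : 0 ≤ c * (kGeo i).M * α₀) (hC1 : c * (kGeo i).M * α₀ * ((d : ℝ) + 1) ≤ 1 / 16)
    (hreg : (bg9K (Matrix (Fin N) (Fin N) ℂ) G i).Reg335 c α₀ U) (Ψ : SiteY i → Matrix (Fin N) (Fin N) ℂ) :
    (1 / 8 : ℝ) * ∑ z : SiteY i, (((((ℓ + 1) ^ (blkOf i.D.toDomains z).1.1 : ℕ) : ℝ)) ^ 2)⁻¹ * ∑ a, ∑ b, ‖GpY i (parSymY i) U Ψ z a b‖ ^ 2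
      ≤ trIP (fun _ => (1 : ℝ)) Ψ (GpY i (parSymY i) U Ψ) := by
  have hunit : IsUnit (deltaPrimeAY i (parSymY i) U) := isUnit_deltaPrimeAY_parSymY i hG hreg.1
  have h := trIP_deltaPrimeAY_parSymY_ge_levelMass i hG hC0 hC1 hreg (GpY i (parSymY i) U Ψ)
  have hGp : GpY i (parSymY i) U = Ring.inverse (deltaPrimeAY i (parSymY i) U) := rfl
  rwa [hGp, apply_inverse_of_isUnit hunit, trIP_comm _ _ Ψ] at h

/-- ★★ **«G′(U) ≥ (4(d+1)+1)⁻¹» AT EVERY `G`-VALUED BACKGROUND**, `G ≤ U(N)` (no smallness): `‖Ψ‖²₁ ≤ (4(d+1)+1)·⟨Ψ, G′(U)Ψ⟩₁` — the upper bound of (3.24)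
transported to the (symmetric, positive) inverse of record. [cite: Balaban1985BackgroundPropagators, Thm 3.11 p.416, (3.24)–(3.25) pp.394–395] -/
theorem trIP_self_le_GpY_parSymY (hG : G ≤ B7Prop2Explicit.unitaryUnits (Matrix (Fin N) (Fin N) ℂ)) {U : CfgY (Matrix (Fin N) (Fin N) ℂ) i}
    (hU : ∀ μ x, U μ x ∈ G) (Ψ : SiteY i → Matrix (Fin N) (Fin N) ℂ) :
    trIP (fun _ => (1 : ℝ)) Ψ Ψ ≤ (4 * ((d : ℝ) + 1) + 1) * trIP (fun _ => (1 : ℝ)) Ψ (GpY i (parSymY i) U Ψ) := by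
  have hpd := deltaPrimeAY_parSymY_posDefTr i hG hU
  have hpos : ∀ Φ, 0 ≤ trIP (fun _ => (1 : ℝ)) Φ (deltaPrimeAY i (parSymY i) U Φ) := by
    intro Φ
    by_cases hΦ : Φ = 0
    · rw [hΦ, map_zero, trIP_zero_right]
    · exact (hpd Φ hΦ).le
  have hd1 : (0 : ℝ) < 4 * ((d : ℝ) + 1) + 1 := by positivity
  exact trIP_self_le_ringInverse_of_symm (symm0_parSymY i hG hU) hpos hd1 (trIP_deltaPrimeAY_parSymY_le i hG hU)
    (isUnit_deltaPrimeAY_parSymY i hG hU) Ψ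

end Main

end Literature.MathematicalPhysics.QuantumFieldTheory.Balaban1983to89.B9Thm31SiteGpBoundsReg335Y
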